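import Summits.FinalStateConjecture.FinalStateConjecture.Theorems.EIHFluxBalanceInertialRecessionRechartSpinZero
import Summits.FinalStateConjecture.FinalStateConjecture.Theorems.EIHFluxBalanceInertialRecessionRechartAssembly2

/-!
# Route EIHFluxBalance — `InertialRecession`: the `a = 0` RE-CHARTING THEOREM from lab-time
# causality (no loitering clause, no orientation clause on the chart)

Helper file for the crux `stmt-FinalStateConjecture-10166`
(`Summit.FinalStateConjecture.FinalStateConjecture.Theses.EIHFluxBalance.InertialRecession`),
stub `stub_rechart` (the transfer P2 of line `sublinear-is-free-clean-window-charges`).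

`inertialRecession_spinZero_of_labTime`: antecedent (verbatim) + (aᵢ = 0) + Slaved³ (verbatim) +
velocity convergence + Cesàro (verbatim) + orthochronous frames + eventual lab-time causality
(the registered hypothesis of `stub_rechart`, verbatim) ⇒ the crux conclusion (verbatim). The
kinematic glue is that of `inertialRecession_spinZero_of_causal` (`…RechartSpinZero`); the
decomposition is `exists_finalStateDecomposition_spinZero_of_packages₂` (`…RechartAssembly2`).
[folklore]
-/

noncomputable section

set_option linter.dupNamespace false

open scoped Topology ContDiff InnerProductSpace Manifold ENNReal BigOperators
open Filter Set Metric Topology Function TopologicalSpace Literature.Geometry.Lorentzian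

namespace Summit.FinalStateConjecture.FinalStateConjecture.Theorems

/-- Threshold bookkeeping (registered helper stub `lt_max_of_lt_right_rechart` of the crux item).
[folklore] -/
theorem lt_max_of_lt_right_rechart : ∀ {a b c : ℝ}, a ≤ b → b < c → max a b < c ∨ a < c :=
  fun h1 h2 ↦ Or.inr (h1.trans_lt h2)

/-! ### Orthochronicity is decided at one time -/

/-- **A continuous Lorentz frame is orthochronous at all times if it is at one time**: the time
component `u⁰(t) = (Λ(t)e₀)⁰` is continuous with `|u⁰| ≥ 1`, hence of constant sign. [folklore] -/
theorem lorentz_apply_zero_pos_of_exists {Λ : ℝ → lorentzGroup}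
    (hc : Continuous fun t ↦ ((Λ t : E4 ≃L[ℝ] E4) : E4 →L[ℝ] E4))
    (h : ∃ t, 0 < (((Λ t : E4 ≃L[ℝ] E4) (E4.basisVector 0)) 0)) (t : ℝ) :
    0 < (((Λ t : E4 ≃L[ℝ] E4) (E4.basisVector 0)) 0) := by
  obtain ⟨t₀, ht₀⟩ := h
  by_contra hle
  rw [not_lt] at hle
  have hcont : Continuous fun s ↦ (((Λ s : E4 ≃L[ℝ] E4) (E4.basisVector 0)) 0) :=
    (EuclideanSpace.proj (0 : Fin 4) : E4 →L[ℝ] ℝ).continuous.comp (hc.clm_apply continuous_const)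
  have hmem : (0 : ℝ) ∈ uIcc (((Λ t₀ : E4 ≃L[ℝ] E4) (E4.basisVector 0)) 0)
      (((Λ t : E4 ≃L[ℝ] E4) (E4.basisVector 0)) 0) :=
    mem_uIcc.mpr (Or.inr ⟨hle, ht₀.le⟩)
  obtain ⟨s, -, hs⟩ := intermediate_value_uIcc hcont.continuousOn hmem
  have h1 := one_le_abs_lorentz_apply_zero (Λ s)
  have hs' : (((Λ s : E4 ≃L[ℝ] E4) (E4.basisVector 0)) 0) = 0 := hs
  rw [hs', abs_zero] at h1
  linarith

-- long statement and long bookkeeping proof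
set_option maxHeartbeats 1600000 in
/-- **The `a = 0` RE-CHARTING THEOREM without orientation or loitering clauses.** The crux
antecedent VERBATIM with all spins `aᵢ = 0`, third-order slaving (verbatim), VELOCITY CONVERGENCE
`ξ̇ᵢ → Vᵢ`, Cesàro velocities (verbatim; implied, unused), ORTHOCHRONOUS painted frames, and the
registered hypothesis of `stub_rechart` — EVENTUAL LAB-TIME CAUSALITY of the chart — imply the crux
CONCLUSION. Lab-time causality orients the lab chart (`…RechartOfut`) and, with exhaustion,
replaces the loitering clause (zone lemma, `…RechartZone2`/`…RechartTransfer2`/`…RechartAssembly2`).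
Compared with the registered `stub_rechart` the extra hypotheses are exactly (aᵢ = 0), velocity
convergence and orthochronous frames. [folklore] -/
theorem inertialRecession_spinZero_of_labTime : ∀ (X : Type) [TopologicalSpace X] [ChartedSpace E3 X] [IsManifold (𝓡 3) ((⊤ : ℕ∞) : WithTop ℕ∞) X] [T2Space X] [SecondCountableTopology X] [ConnectedSpace X], ∀ D ∈ admissibleVacuumData X, ∀ 𝒟 : VacuumCauchyDevelopment D, 𝒟.IsMaximal → ∀ (N : ℕ) (M a rin : Fin N → ℝ) (Λ : Fin N → ℝ → lorentzGroup) (ξ : Fin N → ℝ → E3) (γ κ τ₀ : ℝ) (U : Opens E4) (Φ : U → 𝒟.carrier) (O : Set 𝒟.carrier), ((∀ i, Kerr.IsSubextremal (M i) (a i) ∧ Kerr.rMinus (M i) (a i) < rin i ∧ rin i < Kerr.rPlus (M i) (a i)) ∧ (∀ i t, |((Λ i t : E4 ≃L[ℝ] E4) (E4.basisVector 0)) 0| ≤ γ) ∧ (∀ i, ContDiff ℝ ((⊤ : ℕ∞) : WithTop ℕ∞) (ξ i) ∧ ContDiff ℝ ((⊤ : ℕ∞) : WithTop ℕ∞) (fun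 t ↦ ((Λ i t : E4 ≃L[ℝ] E4) : E4 →L[ℝ] E4))) ∧ (∀ i j, i ≠ j → Tendsto (fun t ↦ ‖ξ i t - ξ j t‖) atTop atTop) ∧ (0 < κ ∧ κ < 1 ∧ ∀ i, ∀ᶠ t in atTop, ‖ξ i t‖ ≤ κ ^ 2 * t) ∧ ({x : E4 | τ₀ < x 0 ∧ ∀ i, rin i < Kerr.radius (a i) (poincareInv (Λ i (x 0)) (E4.ofTimeSpace (x 0) (ξ i (x 0))) x)} ⊆ (U : Set E4)) ∧ let B : ModelBackground := ⟨U, fun x ↦ Minkowski.bilin + ∑ i, (boostedKerrBilin (Λ i (x 0)) (E4.ofTimeSpace (x 0) (ξ i (x 0))) (M i) (a i) x - Minkowski.bilin), fun x ↦ x 0, E4.spatialNorm⟩; ContMDiff 𝓘(ℝ, E4) (𝓡 4) ((⊤ : ℕ∞) : WithTop ℕ∞) Φ ∧ Topology.IsOpenEmbedding ((B.lateRegion τ₀).restrict Φ) ∧ Φ '' {x : U | τ₀ < x.1 0 ∧ ∀ i, Kerr.rPlus (M i) (a i) < Kerr.radius (a i) (poincareInv (Λ i (x.1 0)) (E4.ofTimeSpace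 (x.1 0) (ξ i (x.1 0))) x.1)} ⊆ O ∧ Tendsto (fun t ↦ 𝒟.toSpacetime.deviationCk B Φ 3 t) atTop (𝓝 0) ∧ Tendsto (fun t : ℝ ↦ ⨆ x ∈ {x : U | x.1 0 = t ∧ E4.spatialNorm x.1 ≤ κ * t}, ⨆ (m : ℕ) (_ : m ≤ 3), ENNReal.ofReal (1 + √(√((⨅ i, ‖E4.spatial x.1 - ξ i t‖) ^ 7))) * ‖iteratedFDeriv ℝ m (𝒟.toSpacetime.deviationExtend B Φ) x.1‖ₑ) atTop (𝓝 0) ∧ O = Summit.FinalStateConjecture.exteriorOf 𝒟.toCauchyDevelopment (Φ '' {x : U | τ₀ < x.1 0 ∧ ∀ i, Kerr.rPlus (M i) (a i) < Kerr.radius (a i) (poincareInv (Λ i (x.1 0)) (E4.ofTimeSpace (x.1 0) (ξ i (x.1 0))) x.1)}) ∧ ∀ t₁ : ℝ, τ₀ < t₁ → O \ Φ '' {x : U | t₁ < x.1 0 ∧ ∀ i, Kerr.rPlus (M i) (a i) < Kerr.radius (a i) (poincareInv (Λ i (x.1 0)) (E4.ofTimeSpace (x.1 0) (ξ i (x.1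 0))) x.1)} ⊆ 𝒟.metric.causalPast 𝒟.timeOrientation (Φ '' {x : U | x.1 0 = t₁ ∧ ∀ i, Kerr.rPlus (M i) (a i) < Kerr.radius (a i) (poincareInv (Λ i (x.1 0)) (E4.ofTimeSpace (x.1 0) (ξ i (x.1 0))) x.1)})) →
    (∀ i : Fin N, a i = 0) →
    (∀ i : Fin N, (∀ m : ℕ, 1 ≤ m → m ≤ 3 → Tendsto (fun t ↦ iteratedDeriv m (fun s ↦ (((Λ i s : lorentzGroup) : E4 ≃L[ℝ] E4) (E4.basisVector 0))) t) atTop (𝓝 0)) ∧ (∀ m : ℕ, m ≤ 2 → Tendsto (fun t ↦ iteratedDeriv m (fun s ↦ deriv (ξ i) s - (((((Λ i s : lorentzGroup) : E4 ≃L[ℝ] E4) (E4.basisVector 0)) 0)⁻¹ • E4.spatial (((Λ i s : lorentzGroup) : E4 ≃L[ℝ] E4) (E4.basisVector 0)))) t) atTop (𝓝 0)) ∧ (a i ≠ 0 → ∀ m : ℕ, 1 ≤ m → m ≤ 3 → Tendsto (fun t ↦ iteratedDeriv m (fun s ↦ (((Λ i s : lorentzGroup) : E4 ≃L[ℝ]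 E4) (E4.basisVector 3))) t) atTop (𝓝 0))) →
    (∀ i : Fin N, ∃ V : E3, Tendsto (deriv (ξ i)) atTop (𝓝 V)) →
    (∀ i : Fin N, ∃ V : E3, Tendsto (fun t : ℝ ↦ t⁻¹ • ξ i t) atTop (𝓝 V)) →
    (∀ (i : Fin N) (t : ℝ), 0 < (((Λ i t : lorentzGroup) : E4 ≃L[ℝ] E4) (E4.basisVector 0)) 0) →
    (∃ τ₁ : ℝ, ∀ x y : U, (τ₁ < x.1 0 ∧ ∀ i, rin i < Kerr.radius (a i) (poincareInv (Λ i (x.1 0)) (E4.ofTimeSpace (x.1 0) (ξ i (x.1 0))) x.1)) → (τ₁ < y.1 0 ∧ ∀ i, rin i < Kerr.radius (a i) (poincareInv (Λ i (y.1 0)) (E4.ofTimeSpace (y.1 0) (ξ i (y.1 0))) y.1)) → Φ y ∈ 𝒟.metric.causalFuture 𝒟.timeOrientation {Φ x} → x.1 0 ≤ y.1 0) →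
    ∃ (O : Set 𝒟.carrier) (d : FinalStateDecomposition 𝒟.toSpacetime O 2), (∀ i, Kerr.IsSubextremal (d.mass i) (d.spin i)) ∧ O = Summit.FinalStateConjecture.exteriorOf 𝒟.toCauchyDevelopment d.charted ∧ Summit.FinalStateConjecture.HasExhaustiveCharts d := by
  intro X _ _ _ _ _ _ D hD 𝒟 h𝒟 N M a rin Λ ξ γ κ τ₀ U Φ O hL ha hS hVel _ hOrth hT
  obtain ⟨τ₁T, hT₁⟩ := hT
  -- (Ofut) from lab-time causality
  have hOfut : ∃ TO : ℝ, ∀ x : U, TO < x.1 0 → (∀ j, rin j < Kerr.radius (a j)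
      (poincareInv (Λ j (x.1 0)) (E4.ofTimeSpace (x.1 0) (ξ j (x.1 0))) x.1)) → ∀ w : E4, 0 < w 0 →
      𝒟.metric.val (Φ x) (mfderiv 𝓘(ℝ, E4) (𝓡 4) Φ x w) (mfderiv 𝓘(ℝ, E4) (𝓡 4) Φ x w) < 0 →
        𝒟.timeOrientation.IsFutureDirected (mfderiv 𝓘(ℝ, E4) (𝓡 4) Φ x w) := by
    have hsm' := hL.2.2.1
    have hU' : {x : E4 | τ₀ < x 0 ∧ ∀ i, rin i < Kerr.radius (a i) (poincareInv (Λ i (x 0))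
        (E4.ofTimeSpace (x 0) (ξ i (x 0))) x)} ⊆ (U : Set E4) := hL.2.2.2.2.2.1
    have hΦ' : ContMDiff 𝓘(ℝ, E4) (𝓡 4) ∞ Φ := hL.2.2.2.2.2.2.1
    refine ⟨max τ₀ τ₁T, fun x hx hrad w hw htl ↦ ?_⟩
    have hopen := isOpen_setOf_lt_radius_poincareInv a rin Λ ξ (max τ₀ τ₁T)
      (fun i ↦ (hsm' i).2.continuous) (fun i ↦ (hsm' i).1.continuous)
    exact isFutureDirected_mfderiv_of_labTimeCausality hΦ' hopen
      (fun z hz ↦ hU' ⟨(le_max_left _ _).trans_lt hz.1, hz.2⟩)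
      (fun x' y' hx' hy' hJ ↦ hT₁ x' y' ⟨(le_max_right _ _).trans_lt hx'.1, hx'.2⟩
        ⟨(le_max_right _ _).trans_lt hy'.1, hy'.2⟩ hJ) x ⟨hx, hrad⟩ hw htl
  rcases Nat.eq_zero_or_pos N with hN0 | hN
  · subst hN0
    exact inertialRecession_noHoles X D 𝒟 ⟨M, a, rin, Λ, ξ, γ, κ, τ₀, U, Φ, O, hL⟩
  have ha' : a = fun _ ↦ 0 := funext ha
  subst ha'
  obtain ⟨hsub, hγb, hsm, hsep, -, hU, hB⟩ := hL
  obtain ⟨hΦ, hemb, himO, hdev, -, hO, hexh⟩ := hB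
  obtain ⟨TO, hOfut⟩ := hOfut
  beta_reduce at hsub hU hemb himO hdev hO hexh hOfut hT₁
  -- ### kinematics
  have hu0 : ∀ i t, 0 < (((Λ i t : lorentzGroup) : E4 ≃L[ℝ] E4) (E4.basisVector 0)) 0 := hOrth
  have hu1 : ∀ i t, 1 ≤ (((Λ i t : lorentzGroup) : E4 ≃L[ℝ] E4) (E4.basisVector 0)) 0 := fun i t ↦ by
    have := one_le_abs_lorentz_apply_zero (Λ i t)
    rwa [abs_of_pos (hu0 i t)] at this
  have huγ : ∀ i t, (((Λ i t : lorentzGroup) : E4 ≃L[ℝ] E4) (E4.basisVector 0)) 0 ≤ γ := fun i t ↦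
    (le_abs_self _).trans (hγb i t)
  have hγ1 : 1 ≤ γ := (hu1 ⟨0, hN⟩ 0).trans (huγ ⟨0, hN⟩ 0)
  obtain ⟨v, hv⟩ : ∃ v : Fin N → ℝ → E3, v = fun i t ↦
      ((((Λ i t : lorentzGroup) : E4 ≃L[ℝ] E4) (E4.basisVector 0)) 0)⁻¹ •
        E4.spatial (((Λ i t : lorentzGroup) : E4 ≃L[ℝ] E4) (E4.basisVector 0)) := ⟨_, rfl⟩
  have hS1 : ∀ i, ∀ m : ℕ, 1 ≤ m → m ≤ 3 → Tendsto (fun t ↦ iteratedDeriv m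
      (fun s ↦ ((Λ i s : lorentzGroup) : E4 ≃L[ℝ] E4) (E4.basisVector 0)) t) atTop (𝓝 0) :=
    fun i ↦ (hS i).1
  have hS2 : ∀ i, ∀ m : ℕ, m ≤ 2 → Tendsto (fun t ↦ iteratedDeriv m (fun s ↦ deriv (ξ i) s - v i s) t)
      atTop (𝓝 0) := by
    subst hv; exact fun i ↦ (hS i).2.1
  clear hS
  set κ₀ : ℝ := Real.sqrt (1 - (γ ^ 2)⁻¹) with hκ₀
  have hvs : ∀ i t, ‖v i t‖ ≤ κ₀ := fun i t ↦ by
    rw [hv]; exact (norm_labVelocity_le_sqrt (Λ i t) (hu0 i t) (huγ i t)).1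
  have hκ₀1 : κ₀ < 1 := (norm_labVelocity_le_sqrt (Λ ⟨0, hN⟩ 0) (hu0 _ 0) (huγ _ 0)).2
  have hvΛ : ∀ i t, E4.spatial (((Λ i t : lorentzGroup) : E4 ≃L[ℝ] E4) (E4.basisVector 0)) =
      ((((Λ i t : lorentzGroup) : E4 ≃L[ℝ] E4) (E4.basisVector 0)) 0) • v i t := fun i t ↦ by
    rw [hv]; exact spatial_eq_smul_labVelocity (hu0 i t).ne'
  have hucd : ∀ i, ContDiff ℝ ∞ fun t ↦ ((Λ i t : lorentzGroup) : E4 ≃L[ℝ] E4) (E4.basisVector 0) :=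
    fun i ↦ (hsm i).2.clm_apply contDiff_const
  have hvcd : ∀ i, ContDiff ℝ ∞ (v i) := fun i ↦ by
    rw [hv]; exact contDiff_labVelocity (hucd i) fun s ↦ (hu0 i s).ne'
  have hξcd : ∀ i, ContDiff ℝ ∞ (ξ i) := fun i ↦ (hsm i).1
  -- size of the 4-velocity: `‖u‖² = 2(u⁰)² − 1 ≤ 2γ²`
  have huC : ∀ i t, ‖((Λ i t : lorentzGroup) : E4 ≃L[ℝ] E4) (E4.basisVector 0)‖ ≤ Real.sqrt (2 * γ ^ 2) := by
    intro i t
    refine Real.le_sqrt_of_sq_le ?_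
    have h1 := norm_sq_eq_sq_add_spatialNorm_sq (((Λ i t : lorentzGroup) : E4 ≃L[ℝ] E4) (E4.basisVector 0))
    have h2 := lorentz_apply_zero_sq (Λ i t)
    have h3 := huγ i t
    have h4 := hu1 i t
    nlinarith
  -- rates of the lab velocity and of the centre
  have hv0 : ∀ i l, 1 ≤ l → l ≤ 3 → Tendsto (fun t ↦ iteratedDeriv l (v i) t) atTop (𝓝 0) := fun i ↦ by
    rw [hv]
    exact tendsto_iteratedDeriv_labVelocity ((hucd i).of_le (WithTop.coe_le_coe.mpr le_top : ((3 : ℕ∞) : ℕ∞ω) ≤ ((⊤ : ℕ∞) : ℕ∞ω))) (hu1 i)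
      (huC i) (hS1 i)
  have hξ0 : ∀ i l, 2 ≤ l → l ≤ 3 → Tendsto (fun t ↦ iteratedDeriv l (ξ i) t) atTop (𝓝 0) := fun i ↦
    tendsto_iteratedDeriv_centre (hξcd i) (hvcd i) (hS2 i) fun l hl1 hl2 ↦ hv0 i l hl1 (hl2.trans (by norm_num))
  -- velocity limits
  choose V hξV using hVel
  have hmis : ∀ i, Tendsto (fun t ↦ deriv (ξ i) t - v i t) atTop (𝓝 0) := fun i ↦ by
    simpa using hS2 i 0 (Nat.zero_le 2)
  have hvV : ∀ i, Tendsto (v i) atTop (𝓝 (V i)) := fun i ↦ by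
    have h := (hξV i).sub (hmis i)
    rw [sub_zero] at h
    exact h.congr fun t ↦ by simp
  have hV1 : ∀ i, ‖V i‖ < 1 := fun i ↦
    (le_of_tendsto' (hvV i).norm fun t ↦ hvs i t).trans_lt hκ₀1
  have hces : ∀ i, Tendsto (fun t : ℝ ↦ t⁻¹ • ξ i t) atTop (𝓝 (V i)) := fun i ↦
    tendsto_inv_smul_of_tendsto_deriv ((hξcd i).differentiable (by simp)) (hξV i)
  -- eventual bounds on two derivatives
  have hbd : ∀ i, ∀ᶠ t in atTop, (∀ l, 1 ≤ l → l ≤ 2 → ‖iteratedDeriv l (v i) t‖ ≤ ‖(0 : E3)‖ + 1 + ‖V i‖) ∧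
      ∀ l, 1 ≤ l → l ≤ 2 → ‖iteratedDeriv l (ξ i) t‖ ≤ ‖(0 : E3)‖ + 1 + ‖V i‖ := by
    intro i
    have e1 := eventually_norm_le_of_tendsto (hv0 i 1 le_rfl (by norm_num))
    have e2 := eventually_norm_le_of_tendsto (hv0 i 2 (by norm_num) (by norm_num))
    have e3 := eventually_norm_le_of_tendsto (hξV i)
    have e4 := eventually_norm_le_of_tendsto (hξ0 i 2 le_rfl (by norm_num))
    filter_upwards [e1, e2, e3, e4] with t h1 h2 h3 h4
    refine ⟨fun l hl1 hl2 ↦ ?_, fun l hl1 hl2 ↦ ?_⟩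
    · interval_cases l
      · linarith [norm_nonneg (V i)]
      · linarith [norm_nonneg (V i)]
    · interval_cases l
      · rw [iteratedDeriv_one]; simp only [norm_zero]; linarith [h3]
      · linarith [norm_nonneg (V i)]
  obtain ⟨T₀, hT₀⟩ := eventually_atTop.1 (eventually_all.2 hbd)
  set Γ : ℝ := ‖(0 : E3)‖ + 1 + ∑ i, ‖V i‖ with hΓ
  have hΓi : ∀ i, ‖(0 : E3)‖ + 1 + ‖V i‖ ≤ Γ := fun i ↦ by
    have : ‖V i‖ ≤ ∑ i, ‖V i‖ :=
      Finset.single_le_sum (f := fun i ↦ ‖V i‖) (fun i _ ↦ norm_nonneg _) (Finset.mem_univ i)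
    rw [hΓ]; linarith
  have hvb : ∀ j t, T₀ ≤ t → ∀ l, 1 ≤ l → l ≤ 2 → ‖iteratedDeriv l (v j) t‖ ≤ Γ :=
    fun j t ht l hl1 hl2 ↦ ((hT₀ t ht j).1 l hl1 hl2).trans (hΓi j)
  have hξb : ∀ j t, T₀ ≤ t → ∀ l, 1 ≤ l → l ≤ 2 → ‖iteratedDeriv l (ξ j) t‖ ≤ Γ :=
    fun j t ht l hl1 hl2 ↦ ((hT₀ t ht j).2 l hl1 hl2).trans (hΓi j)
  -- `C²` lab deviation
  have hdev2 : Tendsto (fun t ↦ 𝒟.toSpacetime.deviationCk ⟨U, fun x ↦ Minkowski.bilin +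
      ∑ j, (boostedKerrBilin (Λ j (x 0)) (E4.ofTimeSpace (x 0) (ξ j (x 0))) (M j) 0 x -
        Minkowski.bilin), fun x ↦ x 0, E4.spatialNorm⟩ Φ 2 t) atTop (𝓝 0) :=
    tendsto_of_tendsto_of_tendsto_of_le_of_le tendsto_const_nhds hdev (fun _ ↦ zero_le)
      fun t ↦ 𝒟.toSpacetime.deviationCk_mono ⟨U, fun x ↦ Minkowski.bilin +
        ∑ j, (boostedKerrBilin (Λ j (x 0)) (E4.ofTimeSpace (x 0) (ξ j (x 0))) (M j) 0 x -
          Minkowski.bilin), fun x ↦ x 0, E4.spatialNorm⟩ Φ (by norm_num : 2 ≤ 3) t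
  -- ### the decomposition
  have hM : ∀ i, 0 < M i := fun i ↦ (abs_nonneg (0 : ℝ)).trans_lt (hsub i).1
  have hrin : ∀ j, rin j < Kerr.rPlus (M j) 0 := fun j ↦ (hsub j).2.2
  have hembΦ : IsOpenEmbedding (({x : U | τ₀ < x.1 0} : Set U).restrict Φ) := hemb
  exact exists_finalStateDecomposition_spinZero_of_packages₂ 𝒟 ⟨0, hN⟩ M rin hM hrin Λ ξ v hu0 hvΛ U Φ
    hΦ hdev2 hκ₀1 hvs hvcd hξcd hvb hξb hsep V hV1 hvV hξV hξ0 hv0 hces hU hembΦ O hO himO hexh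
    hOfut (fun j ↦ (hsm j).2.continuous) hT₁


-- long statement
set_option maxHeartbeats 400000 in
/-- **The `a = 0` re-charting theorem with orthochronicity required at ONE time per hole**
(continuity of the frames does the rest, `lorentz_apply_zero_pos_of_exists`). [folklore] -/
theorem inertialRecession_spinZero_of_labTime' : ∀ (X : Type) [TopologicalSpace X] [ChartedSpace E3 X] [IsManifold (𝓡 3) ((⊤ : ℕ∞) : WithTop ℕ∞) X] [T2Space X] [SecondCountableTopology X] [ConnectedSpace X], ∀ D ∈ admissibleVacuumData X, ∀ 𝒟 : VacuumCauchyDevelopment D, 𝒟.IsMaximal → ∀ (N : ℕ) (M a rin : Fin N → ℝ) (Λ : Fin N → ℝ → lorentzGroup) (ξ : Fin N → ℝ → E3) (γ κ τ₀ : ℝ) (U : Opens E4) (Φ : U → 𝒟.carrier) (O : Set 𝒟.carrier), ((∀ i, Kerr.IsSubextremal (M i) (a i) ∧ Kerr.rMinus (M i) (a i) < rin i ∧ rin i < Kerr.rPlus (M i) (a i)) ∧ (∀ i t, |((Λ i t : E4 ≃L[ℝ] E4) (E4.basisVector 0)) 0| ≤ γ) ∧ (∀ i, ContDiff ℝ ((⊤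 : ℕ∞) : WithTop ℕ∞) (ξ i) ∧ ContDiff ℝ ((⊤ : ℕ∞) : WithTop ℕ∞) (fun t ↦ ((Λ i t : E4 ≃L[ℝ] E4) : E4 →L[ℝ] E4))) ∧ (∀ i j, i ≠ j → Tendsto (fun t ↦ ‖ξ i t - ξ j t‖) atTop atTop) ∧ (0 < κ ∧ κ < 1 ∧ ∀ i, ∀ᶠ t in atTop, ‖ξ i t‖ ≤ κ ^ 2 * t) ∧ ({x : E4 | τ₀ < x 0 ∧ ∀ i, rin i < Kerr.radius (a i) (poincareInv (Λ i (x 0)) (E4.ofTimeSpace (x 0) (ξ i (x 0))) x)} ⊆ (U : Set E4)) ∧ let B : ModelBackground := ⟨U, fun x ↦ Minkowski.bilin + ∑ i, (boostedKerrBilin (Λ i (x 0)) (E4.ofTimeSpace (x 0) (ξ i (x 0))) (M i) (a i) x - Minkowski.bilin), fun x ↦ x 0, E4.spatialNorm⟩; ContMDiff 𝓘(ℝ, E4) (𝓡 4) ((⊤ : ℕ∞) : WithTop ℕ∞) Φ ∧ Topology.IsOpenEmbedding ((B.lateRegion τ₀).restrict Φ) ∧ Φ '' {x : U | τ₀ <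 x.1 0 ∧ ∀ i, Kerr.rPlus (M i) (a i) < Kerr.radius (a i) (poincareInv (Λ i (x.1 0)) (E4.ofTimeSpace (x.1 0) (ξ i (x.1 0))) x.1)} ⊆ O ∧ Tendsto (fun t ↦ 𝒟.toSpacetime.deviationCk B Φ 3 t) atTop (𝓝 0) ∧ Tendsto (fun t : ℝ ↦ ⨆ x ∈ {x : U | x.1 0 = t ∧ E4.spatialNorm x.1 ≤ κ * t}, ⨆ (m : ℕ) (_ : m ≤ 3), ENNReal.ofReal (1 + √(√((⨅ i, ‖E4.spatial x.1 - ξ i t‖) ^ 7))) * ‖iteratedFDeriv ℝ m (𝒟.toSpacetime.deviationExtend B Φ) x.1‖ₑ) atTop (𝓝 0) ∧ O = Summit.FinalStateConjecture.exteriorOf 𝒟.toCauchyDevelopment (Φ '' {x : U | τ₀ < x.1 0 ∧ ∀ i, Kerr.rPlus (M i) (a i) < Kerr.radius (a i) (poincareInv (Λ i (x.1 0)) (E4.ofTimeSpace (x.1 0) (ξ i (x.1 0))) x.1)}) ∧ ∀ t₁ : ℝ, τ₀ < t₁ → O \ Φ '' {x : U | t₁ < x.1 0 ∧ ∀ i,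 Kerr.rPlus (M i) (a i) < Kerr.radius (a i) (poincareInv (Λ i (x.1 0)) (E4.ofTimeSpace (x.1 0) (ξ i (x.1 0))) x.1)} ⊆ 𝒟.metric.causalPast 𝒟.timeOrientation (Φ '' {x : U | x.1 0 = t₁ ∧ ∀ i, Kerr.rPlus (M i) (a i) < Kerr.radius (a i) (poincareInv (Λ i (x.1 0)) (E4.ofTimeSpace (x.1 0) (ξ i (x.1 0))) x.1)})) →
    (∀ i : Fin N, a i = 0) →
    (∀ i : Fin N, (∀ m : ℕ, 1 ≤ m → m ≤ 3 → Tendsto (fun t ↦ iteratedDeriv m (fun s ↦ (((Λ i s : lorentzGroup) : E4 ≃L[ℝ] E4) (E4.basisVector 0))) t) atTop (𝓝 0)) ∧ (∀ m : ℕ, m ≤ 2 → Tendsto (fun t ↦ iteratedDeriv m (fun s ↦ deriv (ξ i) s - (((((Λ i s : lorentzGroup) : E4 ≃L[ℝ] E4) (E4.basisVector 0)) 0)⁻¹ • E4.spatial (((Λ i s : lorentzGroup) : E4 ≃L[ℝ] E4) (E4.basisVector 0)))) t) atTop (𝓝 0)) ∧ (a i ≠ 0 → ∀ m : ℕ, 1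 ≤ m → m ≤ 3 → Tendsto (fun t ↦ iteratedDeriv m (fun s ↦ (((Λ i s : lorentzGroup) : E4 ≃L[ℝ] E4) (E4.basisVector 3))) t) atTop (𝓝 0))) →
    (∀ i : Fin N, ∃ V : E3, Tendsto (deriv (ξ i)) atTop (𝓝 V)) →
    (∀ i : Fin N, ∃ V : E3, Tendsto (fun t : ℝ ↦ t⁻¹ • ξ i t) atTop (𝓝 V)) →
    (∀ i : Fin N, ∃ t : ℝ, 0 < (((Λ i t : lorentzGroup) : E4 ≃L[ℝ] E4) (E4.basisVector 0)) 0) →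
    (∃ τ₁ : ℝ, ∀ x y : U, (τ₁ < x.1 0 ∧ ∀ i, rin i < Kerr.radius (a i) (poincareInv (Λ i (x.1 0)) (E4.ofTimeSpace (x.1 0) (ξ i (x.1 0))) x.1)) → (τ₁ < y.1 0 ∧ ∀ i, rin i < Kerr.radius (a i) (poincareInv (Λ i (y.1 0)) (E4.ofTimeSpace (y.1 0) (ξ i (y.1 0))) y.1)) → Φ y ∈ 𝒟.metric.causalFuture 𝒟.timeOrientation {Φ x} → x.1 0 ≤ y.1 0) →
    ∃ (O : Set 𝒟.carrier) (d : FinalStateDecomposition 𝒟.toSpacetime O 2), (∀ i, Kerr.IsSubextremal (d.mass i) (d.spin i)) ∧ O = Summit.FinalStateConjecture.exteriorOf 𝒟.toCauchyDevelopment d.charted ∧ Summit.FinalStateConjecture.HasExhaustiveCharts d := by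
  intro X _ _ _ _ _ _ D hD 𝒟 h𝒟 N M a rin Λ ξ γ κ τ₀ U Φ O hL ha hS hVel hCes hOrth hT
  exact inertialRecession_spinZero_of_labTime X D hD 𝒟 h𝒟 N M a rin Λ ξ γ κ τ₀ U Φ O hL ha hS hVel
    hCes (fun i ↦ lorentz_apply_zero_pos_of_exists (hL.2.2.1 i).2.continuous (hOrth i)) hT

end Summit.FinalStateConjecture.FinalStateConjecture.Theorems
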